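import Summits.NavierStokesRegularity.NavierStokesRegularity.Theses.RellichScar
import Summits.NavierStokesRegularity.NavierStokesRegularity.Theorems.ScarRigidity.Negative.LogicAndLoadBearing
import Summits.NavierStokesRegularity.NavierStokesRegularity.Theorems.RellichScarScarRigidityApexMild
import Summits.NavierStokesRegularity.NavierStokesRegularity.Theorems.RellichScarDefs
import Summits.NavierStokesRegularity.NavierStokesRegularity.Theorems.RellichScarScarRigidityMomentLadderReduction
import Summits.NavierStokesRegularity.NavierStokesRegularity.Theorems.RellichScarScarRigidityFarFieldAllOrders
import Summits.NavierStokesRegularity.NavierStokesRegularity.Theorems.RellichScarScarRigidityApexRegularity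
import Summits.NavierStokesRegularity.NavierStokesRegularity.Theorems.RellichScarScarRigidityVorticityDefect
import Summits.NavierStokesRegularity.NavierStokesRegularity.Theorems.RellichScarScarRigidityBiotSavartFarField
import Summits.NavierStokesRegularity.NavierStokesRegularity.Theorems.RellichScarScarRigidityPaintedLadderHigher
import Literature.Analysis.FluidPDE.TypeIAncientMild
import HarnessLib

/-!
# `ScarRigidity` — line `moment-conditioned-rellich`, skeleton v5 (lead a1; v4 + cycle-1 landings)
# (crux stmt-NavierStokesRegularity-11717, route RellichScar)

Skeleton of the THIRD line lead (prover-line-stmt-NavierStokesRegularity-11717-a1-0), built on the landed layer of the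
second lead (b-0): `Theorems/RellichScarDefs.lean` (vocabulary `ScaleInvariantBounds`, `FarDecay`, `IsSolidHarmonic`,
`momentIntegrand`, `RadiativeMomentsVanish`, glue `farDecay_anti`), `Theorems/RellichScarScarRigidityMomentLadderReduction.lean`
(the sorry-free reduction `scarRigidity_of_momentLadder` : crux ⇐ the six registered stub statements S-reg, S-far, PL, Q2, HM,
FSR) and `Theorems/RellichScarScarRigidityFarFieldAllOrders.lean` (`stub_farFieldAllOrders` = S-far, CLOSED).

RESHAPE v4 (same composition idea, different stub set for the painted ladder's first rung):

* `stub_paintedLadder` (PL, registered, all rungs `ℓ ≥ 1`) is DERIVED here from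
  - `stub_paintedLadderRungOne` (ℓ = 1, UNCONDITIONAL: `FarDecay 3 ⇒ FarDecay 4`), itself DERIVED here from two NEW stubs
    · `stub_vorticityDefectDecay` — PRESSURE-FREE first rung at the vorticity level: the antisymmetric gradient
      `A = ∇w − ∇wᵀ` of the twin difference `w = V₁ − V₂` satisfies `∂ₜA = ΔA − (∇G − ∇Gᵀ)`, `G = Δw − (V₁·∇V₁ − V₂·∇V₂)`
      (the pressure Hessian is symmetric and drops out), so time integration from the final slice (where all
      derivatives of `w` vanish off the apex, by `FarDecay 3`) gives `‖∇ᵏA(t,x)‖ ≲ (−t)²/(‖x‖+√(−t))^{6+k}` on the whole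
      slab; and the FIRST MOMENTS `m_{kij}(t) = ∫ y_k A_ij(t,y) dy` (absolutely convergent, `|m(t)| ≲ (−t)`) are constant in
      `t` (IBP: `∫ y_k ΔA_ij = 0`, `∫ y_k (∂_iG_j − ∂_jG_i) = −δ_{ki}∫G_j + δ_{kj}∫G_i = 0` because `G_j = Δw_j − ∂_l(w_l(V₁)_j +
      (V₂)_l w_j)` is a divergence), hence vanish identically — momentum conservation of the pair WITHOUT the pressure;
    · `stub_biotSavartFarField` — single-slice harmonic analysis: a smooth divergence-free field `w` on `ℝ³` with
      `‖∇ⁿw‖ ≤ Lₙ/(‖y‖+a)^{1+n}`, antisymmetric gradient `‖∇ⁿA‖ ≤ Kₙa⁴/(‖y‖+a)^{6+n}` and vanishing first moments of `A`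
      satisfies `‖∇ᵏw(x)‖ ≤ K'a³/‖x‖^{4+k}` for `‖x‖ ≥ a` (`w_j = Σᵢ ∂ᵢΓ ∗ A_ij` by Liouville, Taylor expansion of `∇Γ(x−y)`
      to first order, both moment terms vanish, remainder split at `‖y‖ = ‖x‖/2`; `K'` depends on `L, K, k` only —
      scale invariance);
  - `stub_paintedLadderHigher` (ℓ ≥ 2, conditional on the radiative moments; XL, pressure painting proper).
* `stub_flatScarRigidity` (FSR) is again ONE stub (b-0's v3 split FSR-1 `stub_flatPairGaussianUpgrade` (OPEN) ∘ FSR-2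
  `stub_gaussianScarRigidity` stays registered in the ledger for whoever lands either half).
* `stub_apexRegularity` (S-reg), `stub_quadrupoleDefectVanishes` (Q2, OPEN, held by the lead), `stub_higherMomentsVanish`
  (HM, OPEN) verbatim as registered.

Open `sorry`s after cycle 1 (3): Q2, HM, FSR — S-reg, vorticityDefectDecay, biotSavartFarField, paintedLadderHigher LANDED (see below).
Composition: `ScarRigidity_of := scarRigidity_of_momentLadder S-reg S-far PL Q2 HM FSR` (landed reduction, by name).
Disproof honoured: every stub keeps both Navier–Stokes systems on the whole slab with the apex decay ((A⁺)(B⁺)(B)(C)(C″)(D));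
§5(iii) — rung 1 uses the equations of `V₁, V₂` (both momentum equations enter `∂ₜA`), not the difference inequality;
§7/§9 bear on Q2/HM/FSR only.
-/

noncomputable section

open Set Filter Function MeasureTheory Metric TopologicalSpace
open scoped Topology ENNReal NNReal InnerProductSpace RealInnerProductSpace Laplacian
open Literature.Analysis.FluidPDE
open Summit.NavierStokesRegularity.NavierStokesRegularity.Theses.RellichScar
open Summit.NavierStokesRegularity.NavierStokesRegularity.Theorems.ScarRigidity.Negative

set_option linter.dupNamespace false

namespace Summit.NavierStokesRegularity.NavierStokesRegularity.Theorems.RellichScarScarRigidity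

/-- Physical space. -/
local notation "ℝ³" => EuclideanSpace ℝ (Fin 3)

/-! ## The stubs -/

/-! ### Landed in cycle 1 (lead a1's wave), imported above and used BY NAME below:
* `stub_apexRegularity` — `Theorems/RellichScarScarRigidityApexRegularity.lean` (p116186);
* `stub_vorticityDefectDecay` — `Theorems/RellichScarScarRigidityVorticityDefect.lean` (p120150; helpers p118405 p119712 p119715 p119722);
* `stub_biotSavartFarField` — `Theorems/RellichScarScarRigidityBiotSavartFarField.lean` (p123166; helpers p122477 p122478 p122479 p122480 p122907);
* `stub_paintedLadderHigher` — `Theorems/RellichScarScarRigidityPaintedLadderHigher.lean` (p123343; helpers p120775 p121094 p121417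
  p121602 p122197 p122343 p122549 p122718 p123058), which also proves `farDecay_four_of_three` (rung one by pressure painting,
  a second, independent proof of `stub_paintedLadderRungOne` below).
Earlier: `stub_farFieldAllOrders` (p82645), `stub_apexMildRepresentative` (p73895), the reduction `scarRigidity_of_momentLadder` (p83073). -/

/-- **Q2 — THE QUADRUPOLE DEFECT VANISHES (OPEN; the load-bearing rung, held by the lead).**  Verbatim as registered. -/
theorem stub_quadrupoleDefectVanishes :
    ∀ (V₁ V₂ : ℝ → ℝ³ → ℝ³) (Q₁ Q₂ : ℝ → ℝ³ → ℝ) (C : ℝ), 0 < C →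
      IsTypeIAncientMild C V₁ → IsTypeIAncientMild C V₂ → HasTypeIDecay C V₁ → HasTypeIDecay C V₂ →
      IsClassicalNSSolutionOn (Iio (0 : ℝ)) 1 0 V₁ Q₁ → IsClassicalNSSolutionOn (Iio (0 : ℝ)) 1 0 V₂ Q₂ →
      ScaleInvariantBounds V₁ Q₁ → ScaleInvariantBounds V₂ Q₂ →
      IsBackwardSingularPoint V₁ 0 → IsBackwardSingularPoint V₂ 0 →
      FarDecay 4 V₁ V₂ → RadiativeMomentsVanish 2 V₁ V₂ := by
  sorry

/-- **HM — THE HIGHER RADIATIVE MOMENTS VANISH (OPEN; rungs `ℓ ≥ 3`).**  Verbatim as registered. -/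
theorem stub_higherMomentsVanish :
    ∀ (V₁ V₂ : ℝ → ℝ³ → ℝ³) (Q₁ Q₂ : ℝ → ℝ³ → ℝ) (C : ℝ) (ℓ : ℕ), 0 < C → 3 ≤ ℓ →
      IsTypeIAncientMild C V₁ → IsTypeIAncientMild C V₂ → HasTypeIDecay C V₁ → HasTypeIDecay C V₂ →
      IsClassicalNSSolutionOn (Iio (0 : ℝ)) 1 0 V₁ Q₁ → IsClassicalNSSolutionOn (Iio (0 : ℝ)) 1 0 V₂ Q₂ →
      ScaleInvariantBounds V₁ Q₁ → ScaleInvariantBounds V₂ Q₂ →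
      IsBackwardSingularPoint V₁ 0 → IsBackwardSingularPoint V₂ 0 →
      FarDecay (ℓ + 2) V₁ V₂ → RadiativeMomentsVanish ℓ V₁ V₂ := by
  sorry

/-- **FSR — FLAT SCAR RIGIDITY (XL/open; step (B) of the line).**  Verbatim as registered; b-0's split
FSR-1 (`stub_flatPairGaussianUpgrade`, OPEN) ∘ FSR-2 (`stub_gaussianScarRigidity`) remains available in the registry. -/
theorem stub_flatScarRigidity :
    ∀ (V₁ V₂ : ℝ → ℝ³ → ℝ³) (Q₁ Q₂ : ℝ → ℝ³ → ℝ) (C : ℝ), 0 < C →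
      IsTypeIAncientMild C V₁ → IsTypeIAncientMild C V₂ → HasTypeIDecay C V₁ → HasTypeIDecay C V₂ →
      IsClassicalNSSolutionOn (Iio (0 : ℝ)) 1 0 V₁ Q₁ → IsClassicalNSSolutionOn (Iio (0 : ℝ)) 1 0 V₂ Q₂ →
      ScaleInvariantBounds V₁ Q₁ → ScaleInvariantBounds V₂ Q₂ →
      IsBackwardSingularPoint V₁ 0 → IsBackwardSingularPoint V₂ 0 →
      (∀ N : ℕ, FarDecay N V₁ V₂) → ∀ t < 0, ∀ x : ℝ³, V₁ t x = V₂ t x := by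
  sorry

/-! ## Glue (sorry-free) -/

/-- The difference of two divergence-free differentiable fields is divergence free (the divergence is the trace of
the derivative, which is additive). [folklore] -/
theorem isDivFree_sub {u v : ℝ³ → ℝ³} (hu : VectorCalculus.IsDivFree u) (hv : VectorCalculus.IsDivFree v)
    (hud : Differentiable ℝ u) (hvd : Differentiable ℝ v) :
    VectorCalculus.IsDivFree (fun y => u y - v y) := by
  intro x
  have h := fderiv_fun_sub (hud x) (hvd x)
  unfold VectorCalculus.divergence
  rw [h]
  have hu' := hu x
  have hv' := hv x
  unfold VectorCalculus.divergence at hu' hv'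
  rw [ContinuousLinearMap.toLinearMap_sub, map_sub, hu', hv', sub_zero]

/-- **PL, rung one (unconditional): the scar twins are quartically flat.**  `FarDecay 3 ⇒ FarDecay 4`, from the vorticity
rung and the Biot–Savart far-field lemma at the scale `a = √(−t)` on each slice. -/
theorem stub_paintedLadderRungOne :
    ∀ (V₁ V₂ : ℝ → ℝ³ → ℝ³) (Q₁ Q₂ : ℝ → ℝ³ → ℝ),
      IsClassicalNSSolutionOn (Iio (0 : ℝ)) 1 0 V₁ Q₁ → IsClassicalNSSolutionOn (Iio (0 : ℝ)) 1 0 V₂ Q₂ →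
      ScaleInvariantBounds V₁ Q₁ → ScaleInvariantBounds V₂ Q₂ → FarDecay 3 V₁ V₂ →
      FarDecay 4 V₁ V₂ := by
  intro V₁ V₂ Q₁ Q₂ hcl₁ hcl₂ hB₁ hB₂ hF3
  obtain ⟨hA, hmom⟩ := stub_vorticityDefectDecay V₁ V₂ Q₁ Q₂ hcl₁ hcl₂ hB₁ hB₂ hF3
  choose L₁ hL₁ using hB₁
  choose L₂ hL₂ using hB₂
  choose KA hKA using hA
  intro k
  obtain ⟨K', hK'⟩ := stub_biotSavartFarField (fun n => L₁ n + L₂ n) KA k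
  refine ⟨K', fun t ht x hx => ?_⟩
  have hV₁ : IsSmoothSpaceTimeOn (Iio (0 : ℝ)) V₁ := hcl₁.smooth_velocity
  have hV₂ : IsSmoothSpaceTimeOn (Iio (0 : ℝ)) V₂ := hcl₂.smooth_velocity
  have ha : 0 < Real.sqrt (-t) := Real.sqrt_pos.2 (by linarith)
  have hxpos : 0 < ‖x‖ := ha.trans_le hx
  -- hypotheses of the Biot–Savart lemma on the slice `t`
  have hcd : ContDiff ℝ (⊤ : ℕ∞) (fun y => V₁ t y - V₂ t y) :=
    (hcl₁.contDiff_velocity ht).sub (hcl₂.contDiff_velocity ht)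
  have hdiv : VectorCalculus.IsDivFree (fun y => V₁ t y - V₂ t y) :=
    isDivFree_sub (hcl₁.divFree t ht) (hcl₂.divFree t ht)
      ((hcl₁.contDiff_velocity ht).differentiable (by simp))
      ((hcl₂.contDiff_velocity ht).differentiable (by simp))
  have hbd : ∀ (n : ℕ) (y : ℝ³), ‖iteratedFDeriv ℝ n (fun y => V₁ t y - V₂ t y) y‖ ≤
      (L₁ n + L₂ n) / (‖y‖ + Real.sqrt (-t)) ^ (1 + n) := by
    intro n y
    rw [iteratedFDeriv_sub_slice hV₁ hV₂ n ht y, add_div]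
    exact (norm_sub_le _ _).trans (add_le_add (hL₁ n t ht y).1 (hL₂ n t ht y).1)
  have hsq : (-t) ^ 2 = Real.sqrt (-t) ^ 4 := by
    rw [show (4 : ℕ) = 2 * 2 from rfl, pow_mul, Real.sq_sqrt (by linarith)]
  have hAd : ∀ (n : ℕ) (i j : Fin 3) (y : ℝ³),
      ‖iteratedFDeriv ℝ n (fun z : ℝ³ =>
          (fderiv ℝ (fun z => V₁ t z - V₂ t z) z (EuclideanSpace.single i (1 : ℝ))) j -
          (fderiv ℝ (fun z => V₁ t z - V₂ t z) z (EuclideanSpace.single j (1 : ℝ))) i) y‖ ≤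
        KA n * Real.sqrt (-t) ^ 4 / (‖y‖ + Real.sqrt (-t)) ^ (6 + n) := by
    intro n i j y
    rw [← hsq]
    exact hKA n i j t ht y
  have h := hK' (Real.sqrt (-t)) ha (fun y => V₁ t y - V₂ t y) hcd hdiv hbd hAd (hmom t ht) x hx
  -- `K' a³/‖x‖^{4+k} = K' a⁻¹ (a/‖x‖)^4 / ‖x‖^k`
  have hxk : ‖x‖ ^ (4 + k) = ‖x‖ ^ 4 * ‖x‖ ^ k := pow_add _ _ _
  calc ‖iteratedFDeriv ℝ k (fun y => V₁ t y - V₂ t y) x‖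
      ≤ K' * Real.sqrt (-t) ^ 3 / ‖x‖ ^ (4 + k) := h
    _ = K' * (Real.sqrt (-t))⁻¹ * (Real.sqrt (-t) / ‖x‖) ^ 4 / ‖x‖ ^ k := by
        rw [hxk, div_pow]
        field_simp

/-- **PL — the painted ladder (registered signature, all rungs `ℓ ≥ 1`)**: rung one unconditionally, the higher rungs by
`stub_paintedLadderHigher`. -/
theorem stub_paintedLadder :
    ∀ (V₁ V₂ : ℝ → ℝ³ → ℝ³) (Q₁ Q₂ : ℝ → ℝ³ → ℝ) (C : ℝ) (ℓ : ℕ), 0 < C → 1 ≤ ℓ →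
      IsClassicalNSSolutionOn (Iio (0 : ℝ)) 1 0 V₁ Q₁ → IsClassicalNSSolutionOn (Iio (0 : ℝ)) 1 0 V₂ Q₂ →
      HasTypeIDecay C V₁ → HasTypeIDecay C V₂ →
      ScaleInvariantBounds V₁ Q₁ → ScaleInvariantBounds V₂ Q₂ → FarDecay 3 V₁ V₂ →
      (∀ ℓ' : ℕ, 2 ≤ ℓ' → ℓ' ≤ ℓ → RadiativeMomentsVanish ℓ' V₁ V₂) →
      FarDecay (ℓ + 3) V₁ V₂ := by
  intro V₁ V₂ Q₁ Q₂ C ℓ hC hℓ hcl₁ hcl₂ hd₁ hd₂ hB₁ hB₂ hF3 hmom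
  rcases Nat.lt_or_ge ℓ 2 with h1 | h2
  · have : ℓ = 1 := by omega
    subst this
    exact stub_paintedLadderRungOne V₁ V₂ Q₁ Q₂ hcl₁ hcl₂ hB₁ hB₂ hF3
  · exact stub_paintedLadderHigher V₁ V₂ Q₁ Q₂ C ℓ hC h2 hcl₁ hcl₂ hd₁ hd₂ hB₁ hB₂ hF3 hmom

/-! ## Composition (sorry-free, by the landed reduction) -/

/-- **The line closes the crux modulo its stubs**: `ScarRigidity` from S-reg, S-far (landed), PL, Q2, HM, FSR through the
landed reduction `scarRigidity_of_momentLadder`. -/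
theorem ScarRigidity_of : ScarRigidity :=
  scarRigidity_of_momentLadder stub_apexRegularity stub_farFieldAllOrders stub_paintedLadder
    stub_quadrupoleDefectVanishes stub_higherMomentsVanish stub_flatScarRigidity

/-- The crux, by name (gate shape `theorem … : <route decl>`). -/
theorem scarRigidity_momentLadder_proof : ScarRigidity := ScarRigidity_of

end Summit.NavierStokesRegularity.NavierStokesRegularity.Theorems.RellichScarScarRigidity

end
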